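import Summits.CriticalPhenomena.PercolationContinuityZ3.Theorems.Transplant.SkelPhiNegReachRoomsCy
import HarnessLib

/-!
# N1 (the `{±1}` node), (C) column file (C-S9f): THE LAST CORE AND THE HABITAT POINTS OF THE y′-BAND (v-corridor, `du.1 = 1`) at the record values
# of RULING B.15/B.16 — continuation of (C-S9e): (§3) **the last core (`j = 800`) of the windowed y′-band reads inside the next cell's arrival box
# `cen' ± (b₀ − 1)`** from the TARGET FLOORS `hyL1`/`hyL2` (along, axis `1`) and `hyL3` (across: the drifting-box budget with `B := Wmy + Wpy + 800T`,
# `ρ := 2400 + q_y + 800T`, `E := 800·(n + U)`, `Y := b₀⊥` — the inequality that forces `b₀ ≥ r/4`, RULING B.16); (§4) the habitat points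
# `(σ·j'·v, σ·j'·W_B)` (`j' = min j 800`) of the cores, their membership, size and rooms.

builds on p205010 (kernel theorem, internal audit signed; external expert review pending) — nothing in this file uses p205010; nothing here is a
claim about the open node `SamePDropOfSkeletonNeg`.
Lane `prim-bschramm`, seat `prim-bschramm-p5` (gen 9; (C) lineage); helper file (`--supports stmt-CriticalPhenomena-4575`).
[cite: KozmaNitzan2024, §4 Lemma 11 (pp. 22–23), Lemma 12 (pp. 23–25), p. 26 (M_v, H_{v,x})] [cite: MartineauTassion2017, §3.2 Lemma 3.5, §4.3 Lemma 4.2]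
-/

noncomputable section

namespace Summit.CriticalPhenomena.PercolationContinuityZ3.Theorems

namespace Transplant

namespace Skelφ

namespace CorrRec

open Literature.Probability.Percolation Literature.Probability.LatticeModels
open Literature.Probability.Percolation.KozmaNitzan.Cells (oth oth_ne sgOf sgOf_sign eq_oth_of_ne)
open TwoAxis.Para (modulus)
open ChainPlanar ChainPara

/-- `oth 1 = 0` on `Fin 2`. [folklore] -/
private theorem oth_one'' : oth (1 : Fin 2) = 0 := by decide

section YBandL

variable {A : ℤ} {n : ℕ} {h v vβ c₀' c₁' D : ℤ} {P : PCells2} {ℓ T : ℕ} {aW bL : ℤ}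

/-! ## §3 The last core of the y′-band: the arrival box `cen' ± (b₀ − 1)` -/

/-- **The last core (`j = 800`) of the y′-band reads inside the next cell's arrival box with one unit of margin**, either sign, under the target
floors `hyL1` (`40Δ·(20r₁ − b₀ + 1) + r₁·(U − 1) < r₁·U·(800·sA − q_y − 800T)`), `hyL2` (`r₁·(U·(800·W_B + q_y + 800T) + U − 1) < 40Δ·(20r₁ + b₀ − 1)`)
and `hyL3` (the drifting-box budget with `B := Wmy + Wpy + 800T`, `ρ := 2400 + q_y + 800T`, `E := 800(n + U)`, `Y := b₀⊥`).
[cite: KozmaNitzan2024, §4 Lemma 12 (pp. 23–25), p. 26 (M_v)] -/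
theorem roomsLy (hn : 1 ≤ n) (hA : 0 < A) (hD : 0 < D) (hm : 0 < modulus n h v vβ) (hc₀ : 0 < c₀')
    (hsc0 : c₀' * A * (40 * modulus n h v vβ) = (P.r 0 : ℤ) * D) (hsc1 : c₁' * A * (40 * modulus n h v vβ) = (P.r 1 : ℤ) * D)
    (hΔlo : (n : ℤ) * ℓ - n < modulus n h v vβ) (hΔhi : modulus n h v vβ ≤ (n : ℤ) * ℓ) (b₀ : Fin 2 → ℕ)
    (hyL1 : 40 * modulus n h v vβ * (20 * (P.r 1 : ℤ) - (b₀ 1 : ℕ) + 1) + (P.r 1 : ℤ) * ((shearUnit n h : ℤ) - 1) <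
      (P.r 1 : ℤ) * ((shearUnit n h : ℤ) * (800 * sA n ℓ h - (qy n ℓ h v T aW bL : ℕ) - 800 * T)))
    (hyL2 : (P.r 1 : ℤ) * ((shearUnit n h : ℤ) * (800 * ((Qw n ℓ h : ℕ) : ℤ) + (qy n ℓ h v T aW bL : ℕ) + 800 * T) + shearUnit n h - 1) <
      40 * modulus n h v vβ * (20 * (P.r 1 : ℤ) + (b₀ 1 : ℕ) - 1))
    (hyL3 : (P.r 0 : ℤ) * (modulus n h v vβ * (((Wmy n v : ℕ) : ℤ) + (Wpy n v : ℕ) + 800 * T) +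
        |v| * ((shearUnit n h : ℤ) * ((2400 + ((qy n ℓ h v T aW bL : ℕ) : ℤ) + 800 * T) + 1)) + |v| * (800 * (n + (shearUnit n h : ℤ)))) +
        40 * modulus n h v vβ * n + (P.r 0 : ℤ) * n ≤ 40 * modulus n h v vβ * (n * ((b₀ 0 : ℕ) : ℤ)))
    {du : MDir} (hd : du.1 = 1) :
    let Bd := bandNw n ℓ h v T n NC (qy n ℓ h v T aW bL) NC (qy n ℓ h v T aW bL) (Wmy n v) (Wpy n v) du
    let lo := dLo du.1 (sgOf du) 0 (Bd.aLo (Bd.N + 1)) (Bd.aHi (Bd.N + 1)) (Bd.bLo (Bd.N + 1)) (Bd.bHi (Bd.N + 1))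
    let hi := dHi du.1 (sgOf du) 0 (Bd.aLo (Bd.N + 1)) (Bd.aHi (Bd.N + 1)) (Bd.bLo (Bd.N + 1)) (Bd.bHi (Bd.N + 1))
    (sgOf du = 1 → 20 * (P.r du.1 : ℤ) - (b₀ du.1 : ℕ) + 1 ≤ rdLo A n h v vβ c₀' c₁' D lo hi du.1 ∧
      rdHi A n h v vβ c₀' c₁' D lo hi du.1 ≤ 20 * (P.r du.1 : ℤ) + (b₀ du.1 : ℕ) - 1) ∧
    (sgOf du = -1 → 20 * (P.r du.1 : ℤ) - (b₀ du.1 : ℕ) + 1 ≤ -rdHi A n h v vβ c₀' c₁' D lo hi du.1 ∧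
      -rdLo A n h v vβ c₀' c₁' D lo hi du.1 ≤ 20 * (P.r du.1 : ℤ) + (b₀ du.1 : ℕ) - 1) ∧
    (-((b₀ (oth du.1) : ℕ) : ℤ) + 1 ≤ rdLo A n h v vβ c₀' c₁' D lo hi (oth du.1) ∧
      rdHi A n h v vβ c₀' c₁' D lo hi (oth du.1) ≤ ((b₀ (oth du.1) : ℕ) : ℤ) - 1) := by
  intro Bd lo hi
  dsimp only [Bd, lo, hi]
  rw [bandNw_y (n := n) (ℓ := ℓ) (h := h) (v := v) (T := T) (aW := aW) (bL := bL) hd, hd, oth_one'']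
  obtain ⟨haLo, haHi, hbLo, hbHi, -, -, -, -, hN⟩ := cornersY (n := n) (h := h) (v := v) (ℓ := ℓ) (T := T) (aW := aW) (bL := bL) 800
  set R := yPrmXw n ℓ h v T (qy n ℓ h v T aW bL) NC (Wmy n v) (Wpy n v) with hR
  rw [hN]
  norm_num only
  have hQ : ((Qw n ℓ h : ℕ) : ℤ) = (n : ℤ) * ℓ / (shearUnit n h : ℕ) + 1 := by unfold Qw; push_cast; rfl
  rw [← hQ] at haHi
  obtain ⟨hs1, hs2⟩ := sA_bounds hn ℓ h
  set Q : ℤ := ((Qw n ℓ h : ℕ) : ℤ) with hQdef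
  set qY : ℤ := ((qy n ℓ h v T aW bL : ℕ) : ℤ) with hqY
  set B0 : ℤ := ((Wmy n v : ℕ) : ℤ) + (Wpy n v : ℕ) + 800 * T with hB0
  set ρ : ℤ := 2400 + qY + 800 * T with hρ
  have hΔ : (0 : ℤ) < modulus n h v vβ := hm
  have hT0 : (0 : ℤ) ≤ T := by positivity
  have hq0 : (0 : ℤ) ≤ qY := by positivity
  have hU : (0 : ℤ) ≤ (shearUnit n h : ℤ) := by positivity
  have hU1 : (1 : ℤ) ≤ (shearUnit n h : ℤ) := by
    have : 1 ≤ shearUnit n h := by unfold shearUnit; omega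
    exact_mod_cast this
  have hr1 : (1 : ℤ) ≤ P.r 1 := by exact_mod_cast P.one_le_r 1
  have hWm0 : (0 : ℤ) ≤ ((Wmy n v : ℕ) : ℤ) := by positivity
  have hWp0 : (0 : ℤ) ≤ ((Wpy n v : ℕ) : ℤ) := by positivity
  -- the corners of the last core
  have cLo : R.aLo 800 = 800 * sA n ℓ h - qY - 800 * T := by rw [haLo]; ring
  have cHi : R.aHi 800 = 800 * Q + qY + 800 * T := by rw [haHi]; ring
  have cbL : R.bLo 800 = v * 800 - (((Wmy n v : ℕ) : ℤ) + 800 * T) := by rw [hbLo]; ring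
  have cbH : R.bHi 800 = v * 800 + (((Wpy n v : ℕ) : ℤ) + 800 * T) := by rw [hbHi]; ring
  have dLo' : |R.aLo 800 - 800 * Q| ≤ ρ := by
    rw [cLo, abs_le]
    have e : 800 * sA n ℓ h - qY - 800 * ↑T - 800 * Q = -(800 * (Q - sA n ℓ h)) - qY - 800 * ↑T := by ring
    rw [e]; constructor <;> linarith
  have dHi' : |R.aHi 800 - 800 * Q| ≤ ρ := by
    rw [cHi, abs_le]; constructor <;> linarith
  rcases sgOf_sign du with hs | hs <;> rw [hs]
  · obtain ⟨e1, e0, e1', e0'⟩ := dLoHi_one_zero 1 (R.aLo 800) (R.aHi 800) (R.bLo 800) (R.bHi 800)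
    rw [oth_one''] at e0 e0'
    set lo' := dLo 1 1 0 (R.aLo 800) (R.aHi 800) (R.bLo 800) (R.bHi 800) with hlo'
    set hi' := dHi 1 1 0 (R.aLo 800) (R.aHi 800) (R.bLo 800) (R.bHi 800) with hhi'
    have hanch := anchor_le hn ℓ hΔlo hΔhi (Or.inl rfl : (1 : ℤ) = 1 ∨ (1 : ℤ) = -1) (le_refl 800)
    have k3 := readAcross0_drift (c₁' := c₁') hn hA hD hm hc₀ hsc0 (lo := lo') (hi := hi') (t := 1 * (800 : ℕ)) (B := B0) (c := 1 * (800 : ℕ) * Q)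
      (ρ := ρ) (E := 800 * (n + (shearUnit n h : ℤ))) (Y := ((b₀ 0 : ℕ) : ℤ))
      (by rw [e0, cbL]; push_cast; linarith) (by rw [e0', cbH]; push_cast; linarith)
      (by rw [e1]; push_cast; exact dLo') (by rw [e1']; push_cast; exact dHi') hanch hyL3
    refine ⟨fun _ => ⟨?_, ?_⟩, fun h1 => absurd h1 (by norm_num), k3.1, k3.2⟩
    · refine rdLo_one_ge hD hm hsc1 ?_
      rw [e1, cLo]
      have h0 : (0 : ℤ) ≤ (P.r 1 : ℤ) * ((shearUnit n h : ℤ) - 1) := mul_nonneg (by linarith) (by linarith)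
      linarith [hyL1]
    · refine rdHi_one_le hD hm hsc1 ?_
      rw [e1', cHi]
      linarith [hyL2]
  · obtain ⟨e1, e0, e1', e0'⟩ := dLoHi_neg_zero 1 (R.aLo 800) (R.aHi 800) (R.bLo 800) (R.bHi 800)
    rw [oth_one''] at e0 e0'
    set lo' := dLo 1 (-1) 0 (R.aLo 800) (R.aHi 800) (R.bLo 800) (R.bHi 800) with hlo'
    set hi' := dHi 1 (-1) 0 (R.aLo 800) (R.aHi 800) (R.bLo 800) (R.bHi 800) with hhi'
    have hanch := anchor_le hn ℓ hΔlo hΔhi (Or.inr rfl : (-1 : ℤ) = 1 ∨ (-1 : ℤ) = -1) (le_refl 800)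
    have k3 := readAcross0_drift (c₁' := c₁') hn hA hD hm hc₀ hsc0 (lo := lo') (hi := hi') (t := -1 * (800 : ℕ)) (B := B0) (c := -1 * (800 : ℕ) * Q)
      (ρ := ρ) (E := 800 * (n + (shearUnit n h : ℤ))) (Y := ((b₀ 0 : ℕ) : ℤ))
      (by rw [e0, cbH]; push_cast; linarith) (by rw [e0', cbL]; push_cast; linarith)
      (by rw [e1]; push_cast; rw [show -R.aHi 800 - -800 * Q = -(R.aHi 800 - 800 * Q) by ring, abs_neg]; exact dHi')
      (by rw [e1']; push_cast; rw [show -R.aLo 800 - -800 * Q = -(R.aLo 800 - 800 * Q) by ring, abs_neg]; exact dLo') hanch hyL3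
    refine ⟨fun h1 => absurd h1 (by norm_num), fun _ => ⟨?_, ?_⟩, k3.1, k3.2⟩
    · suffices hh : rdHi A n h v vβ c₀' c₁' D lo' hi' 1 ≤ -(20 * (P.r 1 : ℤ) - (b₀ 1 : ℕ) + 1) by linarith
      refine rdHi_one_le hD hm hsc1 ?_
      rw [e1', cLo]
      linarith [hyL1]
    · suffices hh : -(20 * (P.r 1 : ℤ) + (b₀ 1 : ℕ) - 1) ≤ rdLo A n h v vβ c₀' c₁' D lo' hi' 1 by linarith
      refine rdLo_one_ge hD hm hsc1 ?_
      rw [e1, cHi]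
      have h0 : (0 : ℤ) ≤ (P.r 1 : ℤ) * ((shearUnit n h : ℤ) - 1) := mul_nonneg (by linarith) (by linarith)
      linarith [hyL2]

/-! ## §4 The habitat points of the y′-band cores -/

/-- **The habitat point of core `j` of the y′-band**: `(σ·j'·v, σ·j'·W_B)`, `j' = min j 800`. [this work] -/
def zBy (n ℓ : ℕ) (h v : ℤ) (σ : ℤ) (j : ℕ) : Site 2 := ![σ * ((min j 800 : ℕ) : ℤ) * v, σ * ((min j 800 : ℕ) : ℤ) * (Qw n ℓ h : ℕ)]

/-- The coordinates of the habitat point. [folklore] -/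
theorem zBy_apply (n ℓ : ℕ) (h v σ : ℤ) (j : ℕ) :
    zBy n ℓ h v σ j 0 = σ * ((min j 800 : ℕ) : ℤ) * v ∧ zBy n ℓ h v σ j 1 = σ * ((min j 800 : ℕ) : ℤ) * (Qw n ℓ h : ℕ) := ⟨rfl, rfl⟩

/-- **The habitat point of core `j ≤ 800` lies in core `j`** of the y′-band. [folklore] -/
theorem zBy_mem (hn : 1 ≤ n) {du : MDir} (hd : du.1 = 1) {j : ℕ} (hj1 : 1 ≤ j)
    (hj : j ≤ (bandNw n ℓ h v T n NC (qy n ℓ h v T aW bL) NC (qy n ℓ h v T aW bL) (Wmy n v) (Wpy n v) du).N + 1) :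
    zBy n ℓ h v (sgOf du) j ∈ (bandNw n ℓ h v T n NC (qy n ℓ h v T aW bL) NC (qy n ℓ h v T aW bL) (Wmy n v) (Wpy n v) du).pcore du.1 (sgOf du) 0 j := by
  have _h := hj1
  rw [bandNw_y (n := n) (ℓ := ℓ) (h := h) (v := v) (T := T) (aW := aW) (bL := bL) hd] at hj ⊢
  obtain ⟨haLo, haHi, hbLo, hbHi, -, -, -, -, hN⟩ := cornersY (n := n) (h := h) (v := v) (ℓ := ℓ) (T := T) (aW := aW) (bL := bL) j
  rw [hN] at hj
  have hjm : (min j 800 : ℕ) = j := min_eq_left hj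
  have hσσ : sgOf du * sgOf du = 1 := by rcases sgOf_sign du with hs | hs <;> simp [hs]
  have hQ : ((Qw n ℓ h : ℕ) : ℤ) = (n : ℤ) * ℓ / (shearUnit n h : ℕ) + 1 := by unfold Qw; push_cast; rfl
  obtain ⟨hs1, hs2⟩ := sA_bounds hn ℓ h
  rw [hd, RunPrm.mem_pcore_iff (sgOf_sign du)]
  simp only [RunPrm.InCore, Pi.zero_apply, sub_zero, oth_one'', (zBy_apply n ℓ h v (sgOf du) j).1, (zBy_apply n ℓ h v (sgOf du) j).2, hjm,
    haLo, haHi, hbLo, hbHi]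
  have e1 : sgOf du * (sgOf du * (j : ℤ) * (Qw n ℓ h : ℕ)) = (j : ℤ) * (Qw n ℓ h : ℕ) := by
    calc sgOf du * (sgOf du * (j : ℤ) * (Qw n ℓ h : ℕ)) = (sgOf du * sgOf du) * ((j : ℤ) * (Qw n ℓ h : ℕ)) := by ring
      _ = (j : ℤ) * (Qw n ℓ h : ℕ) := by rw [hσσ, one_mul]
  have e0 : sgOf du * (sgOf du * (j : ℤ) * v) = (j : ℤ) * v := by
    calc sgOf du * (sgOf du * (j : ℤ) * v) = (sgOf du * sgOf du) * ((j : ℤ) * v) := by ring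
      _ = (j : ℤ) * v := by rw [hσσ, one_mul]
  rw [e1, e0, ← hQ]
  have hT0 : (0 : ℤ) ≤ T := by positivity
  have hq0 : (0 : ℤ) ≤ (qy n ℓ h v T aW bL : ℕ) := by positivity
  have hj0 : (0 : ℤ) ≤ j := by positivity
  have hWm0 : (0 : ℤ) ≤ ((Wmy n v : ℕ) : ℤ) := by positivity
  have hWp0 : (0 : ℤ) ≤ ((Wpy n v : ℕ) : ℤ) := by positivity
  have hjT : 0 ≤ (j : ℤ) * T := by positivity
  have hjs : (j : ℤ) * sA n ℓ h ≤ (j : ℤ) * (Qw n ℓ h : ℕ) := mul_le_mul_of_nonneg_left (by linarith) hj0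
  refine ⟨by linarith, by linarith, by linarith, by linarith⟩

/-- **The habitat points are within `800·(n + W_B)` of the origin** (in `ℓ¹`, `|v| ≤ n`). [folklore] -/
theorem zBy_l1 (hvn : |v| ≤ n) (σ : ℤ) (hσ : σ = 1 ∨ σ = -1) (j : ℕ) :
    ((zBy n ℓ h v σ j) 0).natAbs + ((zBy n ℓ h v σ j) 1).natAbs ≤ 800 * (n + Qw n ℓ h) := by
  rw [(zBy_apply n ℓ h v σ j).1, (zBy_apply n ℓ h v σ j).2]
  have hm : (min j 800 : ℕ) ≤ 800 := min_le_right _ _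
  have hσ1 : σ.natAbs = 1 := by rcases hσ with rfl | rfl <;> simp
  have hv' : v.natAbs ≤ n := by
    have := hvn; rw [← Int.natCast_natAbs] at this; exact_mod_cast this
  rw [Int.natAbs_mul, Int.natAbs_mul, Int.natAbs_mul, Int.natAbs_mul, hσ1, Int.natAbs_natCast, Int.natAbs_natCast, one_mul]
  have h1 : (min j 800 : ℕ) * v.natAbs ≤ 800 * n := Nat.mul_le_mul hm hv'
  have h2 : (min j 800 : ℕ) * Qw n ℓ h ≤ 800 * Qw n ℓ h := Nat.mul_le_mul_right _ hm
  rw [Nat.mul_add]; exact Nat.add_le_add h1 h2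

/-- **The habitat points of the y′-band read inside the rooms with one unit of margin**, either sign, under the band floors.
[cite: KozmaNitzan2024, §4 p. 26 (H_{v,x})] -/
theorem roomsZy (hn : 1 ≤ n) (hA : 0 < A) (hD : 0 < D) (hm : 0 < modulus n h v vβ) (hc₀ : 0 < c₀')
    (hsc0 : c₀' * A * (40 * modulus n h v vβ) = (P.r 0 : ℤ) * D) (hsc1 : c₁' * A * (40 * modulus n h v vβ) = (P.r 1 : ℤ) * D)
    (hΔlo : (n : ℤ) * ℓ - n < modulus n h v vβ) (hΔhi : modulus n h v vβ ≤ (n : ℤ) * ℓ)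
    (hby1 : (shearUnit n h : ℤ) * (((qy n ℓ h v T aW bL : ℕ) : ℤ) + 800 * T + (3 * (n * ℓ) / shearUnit n h + 1 : ℕ) + 1) + 2 * modulus n h v vβ ≤
      40 * 5 * modulus n h v vβ)
    (hby2 : (shearUnit n h : ℤ) * (799 * ((Qw n ℓ h : ℕ) : ℤ) + (qy n ℓ h v T aW bL : ℕ) + 800 * T + (3 * (n * ℓ) / shearUnit n h + 1 : ℕ) + 1) +
      2 * modulus n h v vβ ≤ 40 * 22 * modulus n h v vβ)
    (hby3 : (P.r 0 : ℤ) * (modulus n h v vβ * (((Wmy n v : ℕ) : ℤ) + (Wpy n v : ℕ) + 800 * T + n) +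
        |v| * ((shearUnit n h : ℤ) * ((2397 + ((qy n ℓ h v T aW bL : ℕ) : ℤ) + 800 * T + (3 * (n * ℓ) / shearUnit n h + 1 : ℕ)) + 1)) +
        |v| * (800 * (n + (shearUnit n h : ℤ)))) + 40 * modulus n h v vβ * n + (P.r 0 : ℤ) * n ≤ 40 * modulus n h v vβ * (n * (2 * (P.r 0 : ℤ))))
    {du : MDir} (hd : du.1 = 1) (j : ℕ) :
    (sgOf du = 1 → -(5 * (P.r du.1 : ℤ)) + 1 ≤ rdLo A n h v vβ c₀' c₁' D (zBy n ℓ h v (sgOf du) j) (zBy n ℓ h v (sgOf du) j) du.1 ∧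
      rdHi A n h v vβ c₀' c₁' D (zBy n ℓ h v (sgOf du) j) (zBy n ℓ h v (sgOf du) j) du.1 ≤ 22 * (P.r du.1 : ℤ) - 1) ∧
    (sgOf du = -1 → -(5 * (P.r du.1 : ℤ)) + 1 ≤ -rdHi A n h v vβ c₀' c₁' D (zBy n ℓ h v (sgOf du) j) (zBy n ℓ h v (sgOf du) j) du.1 ∧
      -rdLo A n h v vβ c₀' c₁' D (zBy n ℓ h v (sgOf du) j) (zBy n ℓ h v (sgOf du) j) du.1 ≤ 22 * (P.r du.1 : ℤ) - 1) ∧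
    (-(2 * (P.r (oth du.1) : ℤ)) + 1 ≤ rdLo A n h v vβ c₀' c₁' D (zBy n ℓ h v (sgOf du) j) (zBy n ℓ h v (sgOf du) j) (oth du.1) ∧
      rdHi A n h v vβ c₀' c₁' D (zBy n ℓ h v (sgOf du) j) (zBy n ℓ h v (sgOf du) j) (oth du.1) ≤ 2 * (P.r (oth du.1) : ℤ) - 1) := by
  rw [hd, oth_one'']
  obtain ⟨e0, e1⟩ := zBy_apply n ℓ h v (sgOf du) j
  set Q : ℤ := ((Qw n ℓ h : ℕ) : ℤ) with hQdef
  set qY : ℤ := ((qy n ℓ h v T aW bL : ℕ) : ℤ) with hqY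
  set La : ℤ := ((3 * (n * ℓ) / shearUnit n h + 1 : ℕ) : ℤ) with hLadef
  set m8 : ℤ := ((min j 800 : ℕ) : ℤ) with hm8
  have hΔ : (0 : ℤ) < modulus n h v vβ := hm
  have hn0 : (0 : ℤ) ≤ n := by positivity
  have hU : (0 : ℤ) ≤ (shearUnit n h : ℤ) := by positivity
  have hv0 : (0 : ℤ) ≤ |v| := abs_nonneg v
  have hjm : m8 ≤ 800 := by rw [hm8]; exact_mod_cast min_le_right j 800
  have hj0 : (0 : ℤ) ≤ m8 := by positivity
  have hj8 : (min j 800 : ℕ) ≤ 800 := min_le_right _ _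
  have hT0 : (0 : ℤ) ≤ T := by positivity
  have hq0 : (0 : ℤ) ≤ qY := by positivity
  have hLa0 : (0 : ℤ) ≤ La := by positivity
  have hQ0 : (0 : ℤ) ≤ Q := by positivity
  have hQq : Q ≤ qY := by rw [hQdef, hqY]; exact_mod_cast Qw_le_qy n ℓ h v T aW bL
  have hr0 : (0 : ℤ) ≤ P.r 0 := by positivity
  have hWm0 : (0 : ℤ) ≤ ((Wmy n v : ℕ) : ℤ) := by positivity
  have hWp0 : (0 : ℤ) ≤ ((Wpy n v : ℕ) : ℤ) := by positivity
  -- the point budgets from the band floors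
  have pb1 : (shearUnit n h : ℤ) * 0 + 2 * modulus n h v vβ ≤ 40 * 5 * modulus n h v vβ := by
    have : (0 : ℤ) ≤ (shearUnit n h : ℤ) * (qY + 800 * T + La + 1) := by positivity
    linarith [hby1]
  have pb1' : (shearUnit n h : ℤ) * (0 + 1) + 2 * modulus n h v vβ ≤ 40 * 5 * modulus n h v vβ := by
    have : (shearUnit n h : ℤ) * 1 ≤ (shearUnit n h : ℤ) * (qY + 800 * T + La + 1) := mul_le_mul_of_nonneg_left (by linarith) hU
    linarith [hby1]
  have pb2 : (shearUnit n h : ℤ) * (800 * Q + 1) + 2 * modulus n h v vβ ≤ 40 * 22 * modulus n h v vβ := by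
    have : (shearUnit n h : ℤ) * (800 * Q + 1) ≤ (shearUnit n h : ℤ) * (799 * Q + qY + 800 * T + La + 1) := mul_le_mul_of_nonneg_left (by linarith) hU
    linarith [hby2]
  have pb2' : (shearUnit n h : ℤ) * (800 * Q) + 2 * modulus n h v vβ ≤ 40 * 22 * modulus n h v vβ := by
    have : (shearUnit n h : ℤ) * (800 * Q) ≤ (shearUnit n h : ℤ) * (800 * Q + 1) := mul_le_mul_of_nonneg_left (by linarith) hU
    linarith [pb2]
  have pb3 : (P.r 0 : ℤ) * (modulus n h v vβ * 0 + |v| * ((shearUnit n h : ℤ) * (0 + 1)) + |v| * (800 * (n + (shearUnit n h : ℤ)))) +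
      40 * modulus n h v vβ * n + (P.r 0 : ℤ) * n ≤ 40 * modulus n h v vβ * (n * (2 * (P.r 0 : ℤ))) := by
    have h1 : modulus n h v vβ * 0 ≤ modulus n h v vβ * (((Wmy n v : ℕ) : ℤ) + (Wpy n v : ℕ) + 800 * T + n) := by
      rw [mul_zero]; positivity
    have h2 : |v| * ((shearUnit n h : ℤ) * (0 + 1)) ≤ |v| * ((shearUnit n h : ℤ) * ((2397 + qY + 800 * T + La) + 1)) :=
      mul_le_mul_of_nonneg_left (mul_le_mul_of_nonneg_left (by linarith) hU) hv0
    have h3 := mul_le_mul_of_nonneg_left (add_le_add (add_le_add h1 h2) (le_refl (|v| * (800 * (n + (shearUnit n h : ℤ)))))) hr0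
    linarith [hby3]
  have hjQ : m8 * Q ≤ 800 * Q := mul_le_mul_of_nonneg_right hjm hQ0
  have hjQ0 : 0 ≤ m8 * Q := mul_nonneg hj0 hQ0
  rcases sgOf_sign du with hs | hs
  · have g1 : zBy n ℓ h v (sgOf du) j 1 = m8 * Q := by rw [e1, hs, one_mul]
    have g0 : zBy n ℓ h v (sgOf du) j 0 = v * (1 * m8) := by rw [e0, hs]; ring
    have hanch := anchor_le hn ℓ hΔlo hΔhi (Or.inl rfl : (1 : ℤ) = 1 ∨ (1 : ℤ) = -1) hj8
    have k1 := readLo1_of_budget (A := A) (c₀' := c₀') (D := D) hD hm hsc1 (lo := zBy n ℓ h v (sgOf du) j) (hi := zBy n ℓ h v (sgOf du) j) (m := 5)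
      (B := 0) (by rw [g1]; linarith) pb1
    have k2 := readHi1_of_budget (A := A) (c₀' := c₀') (D := D) hD hm hsc1 (lo := zBy n ℓ h v (sgOf du) j) (hi := zBy n ℓ h v (sgOf du) j) (m := 22)
      (B := 800 * Q) (by rw [g1]; exact hjQ) pb2
    have k3 := readAcross0_drift (c₁' := c₁') hn hA hD hm hc₀ hsc0 (lo := zBy n ℓ h v (sgOf du) j) (hi := zBy n ℓ h v (sgOf du) j) (t := 1 * m8) (B := 0)
      (c := 1 * m8 * Q) (ρ := 0) (E := 800 * (n + (shearUnit n h : ℤ))) (Y := 2 * (P.r 0 : ℤ))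
      (by rw [g0]; linarith) (by rw [g0]; linarith) (by rw [g1]; simp) (by rw [g1]; simp) (by rw [hm8]; exact hanch) pb3
    exact ⟨fun _ => ⟨by linarith, by linarith⟩, fun h1 => absurd (hs.symm.trans h1) (by norm_num), by linarith [k3.1], by linarith [k3.2]⟩
  · have g1 : zBy n ℓ h v (sgOf du) j 1 = -(m8 * Q) := by rw [e1, hs]; ring
    have g0 : zBy n ℓ h v (sgOf du) j 0 = v * (-1 * m8) := by rw [e0, hs]; ring
    have hanch := anchor_le hn ℓ hΔlo hΔhi (Or.inr rfl : (-1 : ℤ) = 1 ∨ (-1 : ℤ) = -1) hj8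
    have k1 := readHi1_of_budget (A := A) (c₀' := c₀') (D := D) hD hm hsc1 (lo := zBy n ℓ h v (sgOf du) j) (hi := zBy n ℓ h v (sgOf du) j) (m := 5)
      (B := 0) (by rw [g1]; linarith) pb1'
    have k2 := readLo1_of_budget (A := A) (c₀' := c₀') (D := D) hD hm hsc1 (lo := zBy n ℓ h v (sgOf du) j) (hi := zBy n ℓ h v (sgOf du) j) (m := 22)
      (B := 800 * Q) (by rw [g1]; linarith) pb2'
    have k3 := readAcross0_drift (c₁' := c₁') hn hA hD hm hc₀ hsc0 (lo := zBy n ℓ h v (sgOf du) j) (hi := zBy n ℓ h v (sgOf du) j) (t := -1 * m8) (B := 0)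
      (c := -1 * m8 * Q) (ρ := 0) (E := 800 * (n + (shearUnit n h : ℤ))) (Y := 2 * (P.r 0 : ℤ))
      (by rw [g0]; linarith) (by rw [g0]; linarith) (by rw [g1]; ring_nf; simp) (by rw [g1]; ring_nf; simp) (by rw [hm8]; exact hanch) pb3
    exact ⟨fun h1 => absurd (hs.symm.trans h1) (by norm_num), fun _ => ⟨by linarith, by linarith⟩, by linarith [k3.1], by linarith [k3.2]⟩

end YBandL

end CorrRec

end Skelφ

end Transplant

end Summit.CriticalPhenomena.PercolationContinuityZ3.Theorems

end
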